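import Summits.QuantumFields.BalabanUV.Beta.FP.PerfectSymbol166Holo

/-!
# `BalabanUV.Beta.FP.PerfectSymbol166HoloW` — road «FP» (binder row D1), sub-row **W166-HOLO** (supplier of row H2-P-KER, the owner's
# H2-DESIGN §5 input (P-ii)), PART A2: `Y_∞`, `F_∞` and **the continuum (1.66) multiplier `W_∞ = W166Inf` are CONTINUOUS on the fat box (off the
# zeros of `F_∞`) and HOLOMORPHIC IN EVERY COORDINATE SLICE** — in particular on the zero-free strip `Strip d κ`, `0 ≤ κ ≤ κ₁₆₆(d)`

HONEST FRAMING (cell contract, verbatim): «discharging `BetaPertH` makes Bałaban's UV stability UNCONDITIONAL — a real constructive-QFT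
result; it is NOT the continuum limit and NOT the Clay problem.»  HONEST DEPENDENCY (verbatim): «continuum YM on T⁴ ⇐ BetaPertH ∧ nine
spine estimates (0/9 proved); BetaPertH ⇐ (D1) ∧ (D4) ∧ CAP+tail; G-an2-4 gates asym, D1 and NE2/3/4.»  THIS MODULE DISCHARGES NOTHING of
D1 / BetaPertH: [folklore] continuity / one-variable holomorphy bookkeeping (sums, products, quotients) over PART A1 (`FP/PerfectSymbol166Holo`:
`u_∞`, `U_∞`, `T_∞`, the series `R̃_∞`) and the tree's `F66Inf_ne_zero` BY NAME.  No `def … : Prop`; nothing is cited; 0 sorry.  NOT summit progress;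
NOT BetaPertH, NOT continuum, NOT Clay.

ABSOLUTE RULE (cell, verbatim): «No internally-minted statement may enter as a cited fact. Every hypothesis is either kernel-proved in this
package or a verbatim quotation of a PUBLISHED theorem with page reference. The manuscript(s) under audit are NOT citable for their own
disputed steps — they are the thing under adjudication; programme-internal (2001/route/tribunal) claims are never citable.»

CONTENT (`r ≤ 1/4`, `d·r² ≤ 1/16`; `Fat`/`FatO` the closed/open fat boxes, slices `z ↦ X (Function.update p i z)` at `p i`):
* §5 `c_∞`, `Σ_ν p_ν²` (everywhere), `Y_∞(λ;·)`, `F_∞`, `Π_{λ∉{μ,ν}} Y_∞` — continuous on `Fat d r`, slice-holomorphic at the points of `FatO d r`;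
  **`continuousOn_W166Inf`** (on `{p ∈ Fat d r | F_∞(p) ≠ 0}`), **`differentiableAt_W166Inf_slice`** (at `p i`, `p ∈ Fat d r` with `p i` in the open box, `F_∞(p) ≠ 0`, every `i`);
* §6 the zero-free strip (`0 ≤ κ ≤ κ₁₆₆(d)` ⟹ `F_∞ ≠ 0`, `F66Inf_ne_zero`): **`continuousOn_W166Inf_strip`** (in particular on the real Brillouin zone,
  `κ = 0`), `continuousOn_F66Inf_strip`, **`differentiableAt_W166Inf_slice_strip`** / `differentiableOn_W166Inf_slice_strip` (base point in the closed strip,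
  slice variable in the open rectangle `rectO κ = {|Re z| < π, |Im z| < κ}`) — the slice-holomorphy field of `B4ContourShift.StripRegular` for the
  `k = ∞` multiplier (assembled with continuity, side matching and the bound `MW` in PART B).
Unit `b2b-balaban-beta-d1-formalise-leaf-01` (gen 8).
-/

noncomputable section

namespace Summit.QuantumFields.BalabanUV.Beta.FP.PerfectSymbol166HoloW

open Filter Topology Finset Complex
open scoped BigOperators
open Literature.MathematicalPhysics.QuantumFieldTheory.Balaban1983to89
open B4Strip (S1 Strip)
open B4StripCauchy (Fat strip_subset_fat rOf rOf_pos rOf_le d_mul_rOf_sq_le differentiable_S1 differentiable_update_apply)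
open B5Symbol166Strip (kappa166 kappa166_le_rOf)
open Summit.QuantumFields.BalabanUV.Beta.FP.PerfectSymbolAlias
open Summit.QuantumFields.BalabanUV.Beta.FP.PerfectSymbol166
open Summit.QuantumFields.BalabanUV.Beta.FP.PerfectSymbol166Holo

variable {d : ℕ}

section Slices

variable {r : ℝ} (hr : r ≤ 1 / 4)
include hr

/-! ## §5 Assembly: `c_∞`, `Σp²`, `Y_∞`, `F_∞`, `W_∞` -/

/-- [folklore] `c_∞(λ;·)` is continuous at fat points. -/
theorem continuousAt_cfacInf {p : Fin d → ℂ} (hp : p ∈ Fat d r) (lam : Fin d) : ContinuousAt (cfacInf lam) p := by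
  unfold cfacInf
  refine (continuousAt_UInf hr hp 0).mul ?_
  exact ContinuousAt.comp (f := fun q : Fin d → ℂ => q lam) (x := p)
    (continuousAt_uInf (Or.inr rfl)) (continuous_apply lam).continuousAt

/-- [folklore] slice holomorphy of `c_∞` at fat points. -/
theorem differentiableAt_cfacInf_slice {p : Fin d → ℂ} (hp : p ∈ Fat d r) (i lam : Fin d) :
    DifferentiableAt ℂ (fun z : ℂ => cfacInf lam (Function.update p i z)) (p i) := by
  unfold cfacInf
  refine (differentiableAt_UInf_slice hr hp i 0).mul ?_
  exact (differentiable_uInf_zero _).comp (p i) (differentiable_update_apply p i lam (p i))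

omit hr in
/-- [folklore] `Σ_ν p_ν²` is continuous. -/
theorem continuous_D0Inf : Continuous (D0Inf (d := d)) := by unfold D0Inf; fun_prop

omit hr in
/-- [folklore] slice holomorphy of `Σ_ν p_ν²`. -/
theorem differentiableAt_D0Inf_slice (p : Fin d → ℂ) (i : Fin d) (z : ℂ) :
    DifferentiableAt ℂ (fun w : ℂ => D0Inf (Function.update p i w)) z := by
  unfold D0Inf
  exact DifferentiableAt.fun_sum fun ν _ => ((differentiable_update_apply p i ν).pow 2) z

/-- [folklore] **`Y_∞(λ;·)` is continuous on the fat box.** -/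
theorem continuousOn_YcInf (hdr : (d : ℝ) * r ^ 2 ≤ 1 / 16) (lam : Fin d) : ContinuousOn (YcInf (d := d) lam) (Fat d r) := by
  have hc : ContinuousOn (cfacInf lam) (Fat d r) := fun p hp => (continuousAt_cfacInf hr hp lam).continuousWithinAt
  unfold YcInf
  exact hc.add (continuous_D0Inf.continuousOn.mul (continuousOn_RtInf hr hdr lam))

/-- [folklore] **slice holomorphy of `Y_∞`** at `p i` (`p` fat, `p i` in the open box). -/
theorem differentiableAt_YcInf_slice (hdr : (d : ℝ) * r ^ 2 ≤ 1 / 16) {p : Fin d → ℂ} (hp : p ∈ Fat d r) {i : Fin d}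
    (hi : p i ∈ boxO r) (lam : Fin d) : DifferentiableAt ℂ (fun z : ℂ => YcInf lam (Function.update p i z)) (p i) := by
  unfold YcInf
  exact (differentiableAt_cfacInf_slice hr hp i lam).add
    ((differentiableAt_D0Inf_slice p i (p i)).mul (differentiableAt_RtInf_slice hr hdr hp hi lam))

/-- [folklore] **`F_∞` is continuous on the fat box.** -/
theorem continuousOn_F66Inf (hdr : (d : ℝ) * r ^ 2 ≤ 1 / 16) : ContinuousOn (F66Inf (d := d)) (Fat d r) := by
  have hc : ∀ lam, ContinuousOn (cfacInf lam) (Fat d r) := fun lam p hp => (continuousAt_cfacInf hr hp lam).continuousWithinAt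
  have hR : ∀ lam, ContinuousOn (RtInf lam) (Fat d r) := fun lam => continuousOn_RtInf hr hdr lam
  unfold F66Inf
  refine ((continuousOn_UInf hr 0).pow d).add (continuousOn_finsetSum _ fun lam _ => ?_)
  refine ((differentiable_S1.continuous.comp (continuous_apply lam)).continuousOn).mul (continuousOn_finsetSum _ fun T _ => ?_)
  refine (continuous_D0Inf.continuousOn.pow _).mul ?_
  exact (continuousOn_finsetProd _ fun lam' _ => hR lam').mul (continuousOn_finsetProd _ fun lam' _ => hc lam')

/-- [folklore] **slice holomorphy of `F_∞`** at `p i` (`p` fat, `p i` in the open box). -/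
theorem differentiableAt_F66Inf_slice (hdr : (d : ℝ) * r ^ 2 ≤ 1 / 16) {p : Fin d → ℂ} (hp : p ∈ Fat d r) {i : Fin d}
    (hi : p i ∈ boxO r) : DifferentiableAt ℂ (fun z : ℂ => F66Inf (Function.update p i z)) (p i) := by
  unfold F66Inf
  refine ((differentiableAt_UInf_slice hr hp i 0).pow d).add ?_
  refine DifferentiableAt.fun_sum fun lam _ => ?_
  refine ((differentiable_S1.comp (differentiable_update_apply p i lam)) (p i)).mul ?_
  refine DifferentiableAt.fun_sum fun T _ => ?_
  refine ((differentiableAt_D0Inf_slice p i (p i)).pow _).mul ?_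
  exact (B5Strip145Analytic.dAt_finset_prod T _ (p i) fun lam' _ => differentiableAt_RtInf_slice hr hdr hp hi lam').mul
    (B5Strip145Analytic.dAt_finset_prod _ _ (p i) fun lam' _ => differentiableAt_cfacInf_slice hr hp i lam')

/-- [folklore] `Π_{λ∉{μ,ν}} Y_∞(λ;·)` is continuous on the fat box. -/
theorem continuousOn_prodYcInf (hdr : (d : ℝ) * r ^ 2 ≤ 1 / 16) (μ ν : Fin d) :
    ContinuousOn (fun p : Fin d → ℂ => ∏ lam ∈ (univ.erase μ).erase ν, YcInf lam p) (Fat d r) :=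
  continuousOn_finsetProd _ fun lam _ => continuousOn_YcInf hr hdr lam

/-- [folklore] slice holomorphy of `Π_{λ∉{μ,ν}} Y_∞` at `p i` (`p` fat, `p i` in the open box). -/
theorem differentiableAt_prodYcInf_slice (hdr : (d : ℝ) * r ^ 2 ≤ 1 / 16) {p : Fin d → ℂ} (hp : p ∈ Fat d r) {i : Fin d}
    (hi : p i ∈ boxO r) (μ ν : Fin d) :
    DifferentiableAt ℂ (fun z : ℂ => ∏ lam ∈ (univ.erase μ).erase ν, YcInf lam (Function.update p i z)) (p i) :=
  B5Strip145Analytic.dAt_finset_prod _ _ (p i) fun lam _ => differentiableAt_YcInf_slice hr hdr hp hi lam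

/-- [folklore] **`W_∞(μ,ν;·)` IS CONTINUOUS ON THE FAT BOX OFF THE ZEROS OF `F_∞`.** -/
theorem continuousOn_W166Inf (hdr : (d : ℝ) * r ^ 2 ≤ 1 / 16) (μ ν : Fin d) :
    ContinuousOn (W166Inf (d := d) μ ν) {p | p ∈ Fat d r ∧ F66Inf p ≠ 0} := by
  intro p hp
  unfold W166Inf
  exact ((continuousOn_prodYcInf hr hdr μ ν p hp.1).mono fun q hq => hq.1).div
    ((continuousOn_F66Inf hr hdr p hp.1).mono fun q hq => hq.1) hp.2

/-- [folklore] **SLICE HOLOMORPHY OF `W_∞`**: for a fat point `p` with `F_∞(p) ≠ 0` and `p i` in the open box, `z ↦ W_∞(μ,ν; update p i z)` is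
holomorphic at `p i` — in EVERY coordinate `i` (the other coordinates may sit on the boundary of the fat box). -/
theorem differentiableAt_W166Inf_slice (hdr : (d : ℝ) * r ^ 2 ≤ 1 / 16) {p : Fin d → ℂ} (hp : p ∈ Fat d r) {i : Fin d}
    (hi : p i ∈ boxO r) (hF : F66Inf p ≠ 0) (μ ν : Fin d) :
    DifferentiableAt ℂ (fun z : ℂ => W166Inf μ ν (Function.update p i z)) (p i) := by
  unfold W166Inf
  exact B5Strip145Analytic.dAt_div (differentiableAt_prodYcInf_slice hr hdr hp hi μ ν) (differentiableAt_F66Inf_slice hr hdr hp hi)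
    (by rw [update_self_eq]; exact hF)

/-- [folklore] the same for a point of the OPEN fat box (all coordinates interior). -/
theorem differentiableAt_W166Inf_slice_fatO (hdr : (d : ℝ) * r ^ 2 ≤ 1 / 16) {p : Fin d → ℂ} (hp : p ∈ FatO d r) (hF : F66Inf p ≠ 0)
    (i μ ν : Fin d) : DifferentiableAt ℂ (fun z : ℂ => W166Inf μ ν (Function.update p i z)) (p i) :=
  differentiableAt_W166Inf_slice hr hdr (fatO_subset_fat r hp) (apply_mem_boxO hp i) hF μ ν

end Slices

/-! ## §6 Strip corollaries (`0 ≤ κ ≤ κ₁₆₆(d)`: the denominator `F_∞` does not vanish on the zero-free strip) -/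

/-- [folklore] **`W_∞(μ,ν;·)` IS CONTINUOUS ON THE ZERO-FREE STRIP** `Strip d κ`, `0 ≤ κ ≤ κ₁₆₆(d)` (in particular on the real Brillouin zone,
`κ = 0`). -/
theorem continuousOn_W166Inf_strip {κ : ℝ} (hκ0 : 0 ≤ κ) (hκ : κ ≤ kappa166 d) (μ ν : Fin d) :
    ContinuousOn (W166Inf (d := d) μ ν) (Strip d κ) :=
  (continuousOn_W166Inf (rOf_le d) (d_mul_rOf_sq_le d) μ ν).mono fun _ hp =>
    ⟨strip_subset_fat_rOf hκ hp, F66Inf_ne_zero hκ0 hκ hp⟩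

/-- [folklore] `F_∞` is continuous on the zero-free strip. -/
theorem continuousOn_F66Inf_strip {κ : ℝ} (hκ : κ ≤ kappa166 d) : ContinuousOn (F66Inf (d := d)) (Strip d κ) :=
  (continuousOn_F66Inf (rOf_le d) (d_mul_rOf_sq_le d)).mono fun _ hp => strip_subset_fat_rOf hκ hp

/-- [folklore] **SLICE HOLOMORPHY OF `W_∞` ON THE STRIP**: for `p ∈ Strip d κ` (`0 ≤ κ ≤ κ₁₆₆(d)`) whose `i`-th coordinate lies in the OPEN
rectangle `{|Re z| < π, |Im z| < κ}`, `z ↦ W_∞(μ,ν; update p i z)` is holomorphic at `p i` (the other coordinates may be any points of the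
closed strip, e.g. real points of the closed Brillouin zone). -/
theorem differentiableAt_W166Inf_slice_strip {κ : ℝ} (hκ0 : 0 ≤ κ) (hκ : κ ≤ kappa166 d) {p : Fin d → ℂ} (hp : p ∈ Strip d κ)
    {i : Fin d} (hi : p i ∈ rectO κ) (μ ν : Fin d) :
    DifferentiableAt ℂ (fun z : ℂ => W166Inf μ ν (Function.update p i z)) (p i) :=
  differentiableAt_W166Inf_slice (rOf_le d) (d_mul_rOf_sq_le d) (strip_subset_fat_rOf hκ hp) (rectO_subset_boxO_rOf hκ hi)
    (F66Inf_ne_zero hκ0 hκ hp) μ ν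

/-- [folklore] the same on the whole open rectangle: for `p ∈ Strip d κ`, `z ↦ W_∞(μ,ν; update p i z)` is holomorphic on
`rectO κ = {|Re z| < π, |Im z| < κ}` — the slice-holomorphy field of `B4ContourShift.StripRegular` for the `k = ∞` multiplier. -/
theorem differentiableOn_W166Inf_slice_strip {κ : ℝ} (hκ0 : 0 ≤ κ) (hκ : κ ≤ kappa166 d) {p : Fin d → ℂ} (hp : p ∈ Strip d κ)
    (i μ ν : Fin d) : DifferentiableOn ℂ (fun z : ℂ => W166Inf μ ν (Function.update p i z)) (rectO κ) := by
  intro z hz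
  have h := differentiableAt_W166Inf_slice_strip hκ0 hκ (update_mem_strip hp i hz) (i := i)
    (by rw [Function.update_self]; exact hz) μ ν
  simp only [Function.update_idem, Function.update_self] at h
  exact h.differentiableWithinAt

end Summit.QuantumFields.BalabanUV.Beta.FP.PerfectSymbol166HoloW

end
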